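import Summits.BirchSwinnertonDyer.BirchSwinnertonDyer.Theorems.ErratumRoadFiveNonSurjCornerKolyJProp44LocalOrder
import Summits.BirchSwinnertonDyer.BirchSwinnertonDyer.Theorems.KolyvaginRoadThreePointCertificate
import Summits.BirchSwinnertonDyer.Rank1Residual.JET.CarrierEndFormsGross1991
import Literature.NumberTheory.EllipticCurves.GrossLMS1991.HeegnerEulerSystemCongruenceImageFree
import HarnessLib

/-!
# T1 JET (cell `bsd-jet`), road K — the END FORMS' binder `h44` (McCallum 1991 Prop. 4.4 «in
# particular») BY NAME from the image-free Literature fact `GrossLMS1991.prop37_2_frobeniusCongruence`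

HONEST FRAMING (programme file §HONESTY, verbatim): «no tranche here proves BSD; ARM L moves the
LITERAL column of an r ≤ 1 census into the kernel-proved-modulo-named-print column.» THEOREMS ONLY
(typer seat `bsd-jet-ty`, session g10; plug (β) of HANDOFF § ty g9); 0 classes move; road-K DOCUMENTARY.

WHAT THIS IS. The road-K END FORMS (`CarrierEndFormsGross1991`, p540775) read the three binders
`JetchevDivisibilityCarrier{Mult,Ne,Add}` from five NAMED statements, one of which is the typed print
fact `McCallum1991.prop44_localOrder_kolyvaginClass_mul_eq` ([McC] Prop. 4.4 «in particular,
`ord d_M(mℓ)_λ = ord c_M(mℓ)_λ = ord c_M(m)_λ`», whose printed proof leans on Kolyvagin's *Euler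
systems* Thm. 3). Cell `bsd-stepL` (seat `corner-p1` g10, `ErratumRoadFiveNonSurjCornerKolyJProp44LocalOrder`,
14:57Z) proved that fact's BODY at a given `(W, K, p)` as a KERNEL theorem
(`Prop44.localOrder_kolyvaginClass_mul_eq_of_congruence`) — binders and conclusion VERBATIM the fact's,
NO image hypothesis — modulo three inputs per pair `(m, mℓ)`:
* (γ) `hγ`: Gross 1991 Prop. 3.7 (2) for the pair (`red(γ·y(mℓ)) = Frob · red(γ·y(m)↑)` at the
  place over `ℓ`), in the currency of `GrossLMS1991.prop37_2_frobeniusCongruence.reductionCongruence`;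
* `hA`/`hA'`: `E(K[·]) ⊆ E(K̄)` admissible for `p^M` at both levels (McCallum (5) / Gross Lemma 4.3);
* `hPt`/`hPt'`: `[P(·)]` is `Γ_K`-invariant mod `p^M` at both levels (McCallum (4) / Gross Prop. 3.6).
Under the FACT'S OWN binders (`ρ̄_{E,p^n}` onto for all `n`, `¬CM`, `K` imaginary quadratic with
`d_K ∉ {−3,−4}` and the Heegner hypothesis, `p` odd, Zhang–Kolyvagin levels) all three are theorems of
the tree: (γ) is the IMAGE-FREE Literature fact `GrossLMS1991.prop37_2_frobeniusCongruence` (Gross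
1991 Prop. 3.7 (2) keyed to Nekovář 2007 Prop. 4.9/4.13 (ii); `bsd-stepL` lit g24, p534286/p535266) read
through `.reductionCongruence` and transported along `mℓ/ℓ = m`; `hA` is x11b3's
`RingClassNoTorsion.isAdmissible_pointsSubgroup` (from `ρ̄_{E,p}` onto, `p` odd);
`hPt` is `KolyCert.toGeomPoints_derivedPoint_mem_invPoints_of_dvd_zhang` (McCallum (4) for CONCRETE data
at Zhang–Kolyvagin levels, image-free) on a data family through the given datum, the other divisors
filled by `nonempty_kolyvaginHeegnerData_of_grossCM` with the two Gross §3 CM facts in their PROVED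
`_holds` form. Hence:

* `prop44_of_frobeniusCongruence (h372 : GrossLMS1991.prop37_2_frobeniusCongruence) :
  McCallum1991.prop44_localOrder_kolyvaginClass_mul_eq` — the print fact `h44` DERIVED from (γ);
* `jetchevDivisibilityCarrier{Mult,Ne,Add}_of_namedPrintGross37 h52 hCV hPT hF1 h372` — the END FORMS
  with binder list {[McC] Prop. 5.2, K5 `JetchevCoreVertexExistence`, Poitou–Tate for Selmer
  structures, F1 `Gross1991_heegnerPoint_sub_ratTorsion_mem_E0`, (γ) `GrossLMS1991.prop37_2_frobeniusCongruence`}.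

References: [cite: McCallumLMS1991, §4 Prop. 4.4 «In particular», Lemma 4.3, (4)–(5) (pp. 299–302)]
[cite: GrossLMS1991, Prop. 3.6, Prop. 3.7 (1)(2), Lemma 4.3, §4 (4.1)]
[cite: Nekovar2007, Prop. 4.9, Prop. 4.13 (ii)] [cite: Jetchev2008, Thm. 1.4, Prop. 4.7 (arXiv) = Prop. 4.4 (p. 821)]
[cite: WZhang2014, Notations (xii)].
-/

set_option autoImplicit false

noncomputable section

open scoped Classical

open WeierstrassCurve IsDedekindDomain NumberField Field Literature.NumberTheory.EllipticCurves
  Literature.NumberTheory.EllipticCurves.ModularForms Literature.NumberTheory.EllipticCurves.Jetchev2008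
  Literature.NumberTheory.EllipticCurves.KolyvaginCocycle
  Literature.NumberTheory.GaloisRepresentations Literature.NumberTheory.GaloisCohomology
  Literature.NumberTheory.GaloisRepresentations.DiscreteGaloisModule
  Summit.BirchSwinnertonDyer.Rank1Residual.X11b Summit.BirchSwinnertonDyer.Rank1Residual.X11b.Three
  Summit.BirchSwinnertonDyer.Rank1Residual.JET.SelmerVocabulary Literature.NumberTheory.Automorphic
  Summit.BirchSwinnertonDyer.BirchSwinnertonDyer.Theorems

namespace Summit.BirchSwinnertonDyer.Rank1Residual.JET

-- `K : Type`: the tree's ring-class class field theory is universe `0`.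
variable {K : Type} [Field K] [NumberField K] {W : WeierstrassCurve ℚ}

/-- (γ) for a pair `(n, a)` with `a = n/ℓ` GIVEN AS AN EQUATION (so that it applies to `(mℓ, m)` through
`mℓ/ℓ = m`): `GrossLMS1991.prop37_2_frobeniusCongruence.reductionCongruence` transported along the
equation of levels. [cite: GrossLMS1991, Prop. 3.7 (2)] [cite: Nekovar2007, Prop. 4.9, Prop. 4.13 (ii)] -/
private theorem reductionCongruence_of_eq (h : GrossLMS1991.prop37_2_frobeniusCongruence)
    [W.IsElliptic] [W.IsGloballyMinimal] [NeZero (W.conductorNorm ℤ)] (hK : IsImaginaryQuadratic K)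
    (hD : NumberField.discr K ≠ -3 ∧ NumberField.discr K ≠ -4)
    (hH : SatisfiesHeegnerHypothesis (W.conductorNorm ℤ) K)
    {Dt : ModularParametrizationData W (W.conductorNorm ℤ)} {β : ℤ} {ι : K →+* ℂ}
    {n : ℕ} (hsq : Squarefree n) (hcop : Nat.Coprime n (W.conductorNorm ℤ)) {ℓ : ℕ}
    (hℓ : ℓ ∈ n.primeFactors) [Fact ℓ.Prime]
    (hℓ2 : ℓ ≠ 2 ∨ (¬ W.HasCM ∧ ∃ p : ℕ, p.Prime ∧ p ≠ 2 ∧ W.HasSurjectiveModNGaloisRep p ∧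
      ∀ q ∈ n.primeFactors,
        Literature.NumberTheory.EllipticCurves.IsKolyvaginPrime (W.conductorNorm ℤ) W K p q))
    (hinert : (Ideal.span {(ℓ : 𝓞 K)}).IsPrime) {a : ℕ} (e : a = n / ℓ)
    (dn : KolyvaginHeegnerData Dt β ι n) (da : KolyvaginHeegnerData Dt β ι a)
    (hΔ : ¬ (ℓ : ℤ) ∣ minimalDiscriminantInt W) {φ₀ : Field.absoluteGaloisGroup (ZMod ℓ)}
    (hφ₀ : ∀ x : AlgebraicClosure (ZMod ℓ), φ₀ • x = x ^ ℓ)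
    (hle : ringClassField K ι a ≤ ringClassField K ι n)
    (γ : ringClassField K ι n ≃ₐ[ℚ] ringClassField K ι n) :
    geomReduction hΔ ((RatClosure.pointsEquiv (K := K) W).symm
        (dn.toGeomPoints (pointGalHom W (ringClassField K ι n) γ dn.y))) =
      φ₀ • geomReduction hΔ ((RatClosure.pointsEquiv (K := K) W).symm
        (dn.toGeomPoints (pointGalHom W (ringClassField K ι n) γ
          (WeierstrassCurve.Affine.Point.map (W' := W)
            ((RingClassField.inclusion ι hle).restrictScalars ℚ) da.y)))) := by
  subst e
  exact h.reductionCongruence rfl hK hD hH hsq hcop hℓ hℓ2 hinert dn da hΔ hφ₀ hle γ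

/-- **McCallum 1991 Prop. 4.4 «in particular» — the typed print fact `h44` of the road-K END FORMS —
DERIVED from the image-free congruence (γ) = `GrossLMS1991.prop37_2_frobeniusCongruence`.** The body
at each `(W, K, p)` is `bsd-stepL`'s kernel theorem `Prop44.localOrder_kolyvaginClass_mul_eq_of_congruence`;
under the fact's own binders (`ρ̄_{E,p^n}` onto, `¬CM`, `d_K ∉ {−3,−4}`, Heegner, `p` odd, Zhang–Kolyvagin
levels) its three per-pair inputs are tree theorems: (γ) from the Literature fact (Zhang–Kolyvagin primes
are Gross–Kolyvagin primes under surjectivity, `ZhangGross.forall_isKolyvaginPrime_of_zhang`, which serves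
the fact's `ℓ = 2` escape clause), admissibility from `isAdmissible_pointsSubgroup`, invariance of `[P(·)]`
from `KolyCert.toGeomPoints_derivedPoint_mem_invPoints_of_dvd_zhang`.
[cite: McCallumLMS1991, §4 Prop. 4.4 «In particular» (p. 301), (4)–(5)] [cite: GrossLMS1991, Prop. 3.6,
Prop. 3.7 (2), Lemma 4.3] [cite: Nekovar2007, Prop. 4.9, Prop. 4.13 (ii)] -/
theorem prop44_of_frobeniusCongruence (h372 : GrossLMS1991.prop37_2_frobeniusCongruence) :
    McCallum1991.prop44_localOrder_kolyvaginClass_mul_eq := by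
  intro W _ _ _ hcm K _ _ hK hD3 hD4 hH p _ hp2 htower Dt β ι M hM m l hsq hl hlm hS d d' hσ hS₁ hS₂
    hemb v hv j
  have hp : p.Prime := Fact.out
  have hsurj : W.HasSurjectiveModNGaloisRep p := by simpa using htower 1
  have hD : NumberField.discr K < -4 := KolyvaginAssembly.discr_lt_neg_four hK ⟨hD3, hD4⟩
  have hND : IsCoprime (W.conductorNorm ℤ : ℤ) (NumberField.discr K) :=
    KolyvaginAssembly.isCoprime_discr_of_satisfiesHeegnerHypothesis hK hH
  have hml0 : m * l ≠ 0 := hsq.ne_zero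
  have hm0 : m ≠ 0 := fun h ↦ hml0 (by rw [h, zero_mul])
  have hml : m ∣ m * l := dvd_mul_right m l
  have hsqm : Squarefree m := hsq.squarefree_of_dvd hml
  have hl' : l ∈ (m * l).primeFactors :=
    Nat.mem_primeFactors.mpr ⟨hl, dvd_mul_left l m, hml0⟩
  have hSm : ∀ q ∈ m.primeFactors, Zhang2014.IsKolyvaginPrime (W.conductorNorm ℤ) W K p q ∧
      M ≤ Zhang2014.kolyvaginIndex W p q :=
    fun q hq ↦ hS q (Nat.primeFactors_mono hml hml0 hq)
  have hinert : ∀ (n : ℕ), n ∣ m * l → ∀ q ∈ n.primeFactors, (Ideal.span {(q : 𝓞 K)}).IsPrime :=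
    fun n hn q hq ↦ (hS q (Nat.primeFactors_mono hn hml0 hq)).1.2.2.2.2.1
  have hcop : Nat.Coprime (m * l) (W.conductorNorm ℤ) :=
    coprime_of_primeFactors_inert hH hml0 (hinert (m * l) dvd_rfl)
  -- McCallum's standing input (5): admissibility at both levels, from `ρ̄_{E,p}` onto
  have hA : IsAdmissible (absoluteGaloisGroup K) d.pointsSubgroup ((p ^ M : ℕ) : ℤ) :=
    RingClassNoTorsion.isAdmissible_pointsSubgroup d hK hm0 hp hp2 hsurj M
  have hA' : IsAdmissible (absoluteGaloisGroup K) d'.pointsSubgroup ((p ^ M : ℕ) : ℤ) :=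
    RingClassNoTorsion.isAdmissible_pointsSubgroup d' hK hml0 hp hp2 hsurj M
  -- McCallum's standing input (4): invariance of `[P(·)]` mod `p^M`, for data families through `d`, `d'`
  have hne : ∀ (n : ℕ), n ∣ m * l → Nonempty (KolyvaginHeegnerData Dt β ι n) := fun n hn ↦
    BirchSwinnertonDyer.Theorems.nonempty_kolyvaginHeegnerData_of_grossCM
      (phi_heegnerPointOfConductor_mem_range_map_ringClassField_holds (W.conductorNorm ℤ) W K)
      exists_generator_ringClassGalOver_holds hK hH Dt β ι d.dvd_sq_sub (hsq.squarefree_of_dvd hn)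
      (hinert n hn)
  let data' : (n : ℕ) → n ∣ m * l → KolyvaginHeegnerData Dt β ι n := fun n hn ↦
    if h : n = m * l then h ▸ d' else (hne n hn).some
  have hdata' : data' (m * l) dvd_rfl = d' := by simp [data']
  let data : (n : ℕ) → n ∣ m → KolyvaginHeegnerData Dt β ι n := fun n hn ↦
    if h : n = m then h ▸ d else (hne n (hn.trans hml)).some
  have hdata : data m dvd_rfl = d := by simp [data]
  have hPt' : d'.toGeomPoints d'.derivedPoint ∈
      invPoints (absoluteGaloisGroup K) d'.pointsSubgroup ((p ^ M : ℕ) : ℤ) := by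
    have h := KolyCert.toGeomPoints_derivedPoint_mem_invPoints_of_dvd_zhang hK ι Dt hp hND hD hsq hS
      data' (m * l) dvd_rfl
    rwa [hdata'] at h
  have hPt : d.toGeomPoints d.derivedPoint ∈
      invPoints (absoluteGaloisGroup K) d.pointsSubgroup ((p ^ M : ℕ) : ℤ) := by
    have h := KolyCert.toGeomPoints_derivedPoint_mem_invPoints_of_dvd_zhang hK ι Dt hp hND hD hsqm hSm
      data m dvd_rfl
    rwa [hdata] at h
  -- (γ) for the pair `(mℓ, m)`: the image-free Literature fact, its `ℓ = 2` clause served by surjectivity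
  have hKolG : ∀ q ∈ (m * l).primeFactors,
      Literature.NumberTheory.EllipticCurves.IsKolyvaginPrime (W.conductorNorm ℤ) W K p q :=
    ZhangGross.forall_isKolyvaginPrime_of_zhang W K hK hp2 hsurj fun q hq ↦ (hS q hq).1
  have hmn : m = m * l / l := (Nat.mul_div_cancel m hl.pos).symm
  exact Prop44.localOrder_kolyvaginClass_mul_eq_of_congruence hK hD3 hD4 hH hp2 Dt β ι M hM m l hsq hl
    hlm hS d d' hσ hS₁ hS₂ hemb
    (fun hΔ φ₀ hφ₀ hle γ _ ↦ reductionCongruence_of_eq h372 hK ⟨hD3, hD4⟩ hH hsq hcop hl'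
      (Or.inr ⟨hcm, p, hp, hp2, hsurj, hKolG⟩) (hinert (m * l) dvd_rfl l hl') hmn d' d hΔ hφ₀ hle γ)
    hA hA' hPt hPt' v hv j

/-- **K3 ⟸ NAMED PRINT with `h44` DERIVED** (multiplicative carrier `p ∣ N`): {[McC] Prop. 5.2, K5 core
vertices, Poitou–Tate for Selmer structures, F1, (γ) Gross Prop. 3.7 (2) image-free}.
[cite: Jetchev2008, Thm. 1.4, Thm. 5.2, Prop. 4.9, Prop. 5.3] [cite: McCallumLMS1991, Prop. 4.4, Prop. 5.2]
[cite: GrossLMS1991, Prop. 3.7, §6] [cite: GrossZagier1986, III (3.1)] -/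
theorem jetchevDivisibilityCarrierMult_of_namedPrintGross37
    (h52 : McCallum1991.prop52_exists_conductor_kolyvaginClass_order_eq)
    (hCV : JetchevCoreVertexExistence)
    (hPT : ∀ (K : Type) [Field K] [NumberField K], poitouTate_selmerStructure_duality_conj K)
    (hF1 : Gross1991_heegnerPoint_sub_ratTorsion_mem_E0)
    (h372 : GrossLMS1991.prop37_2_frobeniusCongruence) :
    JetchevDivisibilityCarrierMult :=
  jetchevDivisibilityCarrierMult_of_namedPrintGross1991 h52 hCV (prop44_of_frobeniusCongruence h372)
    hPT hF1

/-- **K1 ⟸ NAMED PRINT with `h44` DERIVED** (carrier a prime `q ∣ N`, `q ≠ p`).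
[cite: Jetchev2008, Thm. 1.4, Thm. 5.2, Prop. 4.9, Prop. 5.3] [cite: McCallumLMS1991, Prop. 4.4, Prop. 5.2]
[cite: GrossLMS1991, Prop. 3.7, §6] [cite: GrossZagier1986, III (3.1)] -/
theorem jetchevDivisibilityCarrierNe_of_namedPrintGross37
    (h52 : McCallum1991.prop52_exists_conductor_kolyvaginClass_order_eq)
    (hCV : JetchevCoreVertexExistence)
    (hPT : ∀ (K : Type) [Field K] [NumberField K], poitouTate_selmerStructure_duality_conj K)
    (hF1 : Gross1991_heegnerPoint_sub_ratTorsion_mem_E0)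
    (h372 : GrossLMS1991.prop37_2_frobeniusCongruence) :
    JetchevDivisibilityCarrierNe :=
  jetchevDivisibilityCarrierNe_of_namedPrintGross1991 h52 hCV (prop44_of_frobeniusCongruence h372)
    hPT hF1

/-- **K4 ⟸ NAMED PRINT with `h44` DERIVED** (additive carrier `p ∣ N`).
[cite: Jetchev2008, Thm. 1.4, Thm. 5.2, Prop. 4.9, Prop. 5.3] [cite: McCallumLMS1991, Prop. 4.4, Prop. 5.2]
[cite: GrossLMS1991, Prop. 3.7, §6] [cite: GrossZagier1986, III (3.1)] -/
theorem jetchevDivisibilityCarrierAdd_of_namedPrintGross37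
    (h52 : McCallum1991.prop52_exists_conductor_kolyvaginClass_order_eq)
    (hCV : JetchevCoreVertexExistence)
    (hPT : ∀ (K : Type) [Field K] [NumberField K], poitouTate_selmerStructure_duality_conj K)
    (hF1 : Gross1991_heegnerPoint_sub_ratTorsion_mem_E0)
    (h372 : GrossLMS1991.prop37_2_frobeniusCongruence) :
    JetchevDivisibilityCarrierAdd :=
  jetchevDivisibilityCarrierAdd_of_namedPrintGross1991 h52 hCV (prop44_of_frobeniusCongruence h372)
    hPT hF1

end Summit.BirchSwinnertonDyer.Rank1Residual.JET

end
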